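import Literature.Geometry.Manifold.StrataNbhdTautness
import Literature.NumberTheory.Transcendental.KaehlerHodgeOfRealProofs
import Literature.NumberTheory.Transcendental.ComplexFormsProofs
import Literature.NumberTheory.Transcendental.FormIntegrationStokes
import Literature.NumberTheory.Transcendental.ComplexDeRhamRealStructure
import Literature.Geometry.Kaehler.ChernCharacterPullback
import Literature.AlgebraicGeometry.HodgeTheory.LefschetzOneOneCechIntegrality
import HarnessLib

/-!
# Tautness for complex-valued de Rham forms on neighbourhoods of an embedded compact manifold

Topic `Literature/Geometry/Manifold`. The complex-coefficient forms of the two tautness statements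
of `StrataNbhdTautness` (Spanier (1966), Ch. 6 §1, Thm. 10, through Bredon (1993), Thm. V.9.5),
for a `C^∞` embedding `f : P → M` of a compact manifold into a compact manifold, both real-`C^∞`
manifolds charted on complex normed spaces (so that complex forms have real and imaginary parts,
`MForm.re` / `MForm.im` of `KaehlerHodge.lean`):

* `exists_nhd_restr_mem_localExactForms_of_pullback_eq_mextDeriv_complex` (T1, positive degree),
  `exists_nhd_restr_eq_zero_of_pullback_eq_zero_complex` (T1, degree `0`);
* `exists_nhd_pullback_eq_add_mextDeriv_complex` (T2, positive degree),
  `exists_nhd_pullback_eq_complex` (T2, degree `0`).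

They follow from the real statements applied to real and imaginary parts; §1 supplies the
pointwise calculus of real/imaginary parts of forms on open subsets (smoothness at a point,
`d` at a smooth point, restriction, pull-back). Everything is proved; no named facts (D-0026).
Brick [C₁'] of the direct route to Deligne's Hodge III, Cor. 8.2.8 on the tree's compact Kähler
carriers (`Literature/AlgebraicGeometry/HodgeTheory/GysinKernelSplitRationalCore.lean`).

## References

* E. H. Spanier, *Algebraic Topology*, Springer 1981, Ch. 6 §1, Thm. 10. [Spanier1981]
* G. E. Bredon, *Topology and Geometry*, GTM 139 (1993), Thm. V.9.5. [Bredon1993]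
* R. O. Wells, *Differential Analysis on Complex Manifolds* (1980), Ch. I §3, Ch. II §1 (real and
  imaginary parts of forms; `d` is a real operator). [Wells1980]
-/

noncomputable section

open scoped Manifold ContDiff Topology
open Set Literature.Geometry.Kaehler Literature.NumberTheory.Transcendental
open Literature.AlgebraicGeometry.HodgeTheory (smoothAt_re smoothAt_im re_mextDeriv_apply_of_smoothAt
  im_mextDeriv_apply_of_smoothAt)
open _root_.Topology

universe u

/-! ### §1 Real and imaginary parts of forms on open subsets (pointwise calculus) -/

namespace Literature.Geometry.Kaehler

section RealImag

variable {E : Type*} [NormedAddCommGroup E] [NormedSpace ℂ E]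
  {M : Type*} [TopologicalSpace M] [ChartedSpace E M] {k : ℕ}

/-- The complexification of a real form smooth at `x` is smooth at `x`. [cite: Wells1980, Ch. I §3] -/
theorem MForm.SmoothAt.ofReal {β : MForm 𝓘(ℝ, E) M ℝ k} {x : M} (hβ : β.SmoothAt x) :
    β.ofReal.SmoothAt x := by
  rw [MForm.SmoothAt, MForm.inChart_ofReal]
  exact ((ContinuousLinearMap.compContinuousAlternatingMapCLM ℝ E ℝ ℂ (Fin k)
    Complex.ofRealCLM).contDiff.of_le le_top).comp_contDiffWithinAt hβ

/-- `Re` commutes with restriction (extension by zero). [folklore] -/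
theorem MForm.re_restr (U : Set M) (α : MForm 𝓘(ℝ, E) M ℂ k) : (α.restr U).re = α.re.restr U := by
  funext x
  by_cases hx : x ∈ U
  · ext v; simp [MForm.restr_apply_of_mem _ hx]
  · ext v; simp [MForm.restr_apply_of_notMem _ hx]

/-- `Im` commutes with restriction (extension by zero). [folklore] -/
theorem MForm.im_restr (U : Set M) (α : MForm 𝓘(ℝ, E) M ℂ k) : (α.restr U).im = α.im.restr U := by
  funext x
  by_cases hx : x ∈ U
  · ext v; simp [MForm.restr_apply_of_mem _ hx]
  · ext v; simp [MForm.restr_apply_of_notMem _ hx]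

/-- Complexification commutes with restriction (extension by zero). [folklore] -/
theorem MForm.ofReal_restr (U : Set M) (β : MForm 𝓘(ℝ, E) M ℝ k) :
    (β.restr U).ofReal = β.ofReal.restr U := by
  funext x
  by_cases hx : x ∈ U
  · ext v; simp [MForm.restr_apply_of_mem _ hx]
  · ext v; simp [MForm.restr_apply_of_notMem _ hx]

variable {E' : Type*} [NormedAddCommGroup E'] [NormedSpace ℂ E']
  {N : Type*} [TopologicalSpace N] [ChartedSpace E' N]

/-- Complexification commutes with pull-back. [folklore] -/
theorem MForm.ofReal_pullback (g : N → M) (β : MForm 𝓘(ℝ, E) M ℝ k) :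
    (β.pullback 𝓘(ℝ, E') g).ofReal = β.ofReal.pullback 𝓘(ℝ, E') g := by
  funext x; ext v; rfl

/-- The pull-back of a restriction along a map landing in the restricting set is the pull-back.
[folklore] -/
theorem MForm.pullback_restr_of_forall_mem {F : Type*} [NormedAddCommGroup F] [NormedSpace ℝ F]
    {g : N → M} {U : Set M} (hg : ∀ y, g y ∈ U) (α : MForm 𝓘(ℝ, E) M F k) :
    (α.restr U).pullback 𝓘(ℝ, E') g = α.pullback 𝓘(ℝ, E') g := by
  funext y; ext v
  simp [MForm.pullback_apply, MForm.restr_apply_of_mem _ (hg y)]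

/-- The real part of a form on `U` is a form on `U`. [folklore] -/
theorem re_mem_smoothFormsOn {U : Set M} {α : MForm 𝓘(ℝ, E) M ℂ k} (hα : α ∈ smoothFormsOn 𝓘(ℝ, E) ℂ U k) :
    α.re ∈ smoothFormsOn 𝓘(ℝ, E) ℝ U k :=
  ⟨fun x hx ↦ smoothAt_re (hα.1 x hx), fun x hx ↦ by ext v; simp [hα.2 x hx]⟩

/-- The imaginary part of a form on `U` is a form on `U`. [folklore] -/
theorem im_mem_smoothFormsOn {U : Set M} {α : MForm 𝓘(ℝ, E) M ℂ k} (hα : α ∈ smoothFormsOn 𝓘(ℝ, E) ℂ U k) :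
    α.im ∈ smoothFormsOn 𝓘(ℝ, E) ℝ U k :=
  ⟨fun x hx ↦ smoothAt_im (hα.1 x hx), fun x hx ↦ by ext v; simp [hα.2 x hx]⟩

/-- The complexification of a real form on `U` is a form on `U`. [folklore] -/
theorem ofReal_mem_smoothFormsOn {U : Set M} {β : MForm 𝓘(ℝ, E) M ℝ k}
    (hβ : β ∈ smoothFormsOn 𝓘(ℝ, E) ℝ U k) : β.ofReal ∈ smoothFormsOn 𝓘(ℝ, E) ℂ U k :=
  ⟨fun x hx ↦ (hβ.1 x hx).ofReal, fun x hx ↦ by ext v; simp [hβ.2 x hx]⟩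

/-- Complex multiples of a form on `U` are forms on `U`. [folklore] -/
theorem smul_complex_mem_smoothFormsOn {U : Set M} (c : ℂ) {α : MForm 𝓘(ℝ, E) M ℂ k}
    (hα : α ∈ smoothFormsOn 𝓘(ℝ, E) ℂ U k) : c • α ∈ smoothFormsOn 𝓘(ℝ, E) ℂ U k :=
  ⟨fun x hx ↦ (hα.1 x hx).smul_complex c, fun x hx ↦ by
    change c • α x = 0; rw [hα.2 x hx, smul_zero]⟩

/-- The real part of a closed form on `U` is closed on `U`. [cite: Wells1980, Ch. II §1] -/
theorem re_mem_localClosedForms {U : Set M} {α : MForm 𝓘(ℝ, E) M ℂ k}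
    (hα : α ∈ localClosedForms 𝓘(ℝ, E) ℂ k U) : α.re ∈ localClosedForms 𝓘(ℝ, E) ℝ k U :=
  ⟨re_mem_smoothFormsOn hα.1, fun x hx ↦ by
    rw [← re_mextDeriv_apply_of_smoothAt (hα.1.1 x hx)]
    change Complex.reCLM.compContinuousAlternatingMap (mextDeriv α x) = 0
    rw [hα.2 x hx]; ext v; simp⟩

/-- The imaginary part of a closed form on `U` is closed on `U`. [cite: Wells1980, Ch. II §1] -/
theorem im_mem_localClosedForms {U : Set M} {α : MForm 𝓘(ℝ, E) M ℂ k}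
    (hα : α ∈ localClosedForms 𝓘(ℝ, E) ℂ k U) : α.im ∈ localClosedForms 𝓘(ℝ, E) ℝ k U :=
  ⟨im_mem_smoothFormsOn hα.1, fun x hx ↦ by
    rw [← im_mextDeriv_apply_of_smoothAt (hα.1.1 x hx)]
    change Complex.imCLM.compContinuousAlternatingMap (mextDeriv α x) = 0
    rw [hα.2 x hx]; ext v; simp⟩

/-- A complex form vanishes at a point where its real and imaginary parts vanish. [folklore] -/
theorem MForm.apply_eq_zero_of_re_of_im {j : ℕ} (α : MForm 𝓘(ℝ, E) M ℂ j) {x : M} (hre : α.re x = 0)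
    (him : α.im x = 0) : α x = 0 := by
  have key := congrFun (MForm.ofReal_re_add_I_smul_ofReal_im α) x
  rw [← key, Pi.add_apply, Pi.smul_apply]
  change Complex.ofRealCLM.compContinuousAlternatingMap (α.re x) +
    Complex.I • Complex.ofRealCLM.compContinuousAlternatingMap (α.im x) = 0
  rw [hre, him]; ext v; simp

/-- Two complex forms agree at a point where their real and imaginary parts agree. [folklore] -/
theorem MForm.apply_eq_of_re_of_im {j : ℕ} (α β : MForm 𝓘(ℝ, E) M ℂ j) {x : M} (hre : α.re x = β.re x)
    (him : α.im x = β.im x) : α x = β x := by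
  have kα := congrFun (MForm.ofReal_re_add_I_smul_ofReal_im α) x
  have kβ := congrFun (MForm.ofReal_re_add_I_smul_ofReal_im β) x
  rw [← kα, ← kβ, Pi.add_apply, Pi.smul_apply, Pi.add_apply, Pi.smul_apply]
  change Complex.ofRealCLM.compContinuousAlternatingMap (α.re x) +
      Complex.I • Complex.ofRealCLM.compContinuousAlternatingMap (α.im x) =
    Complex.ofRealCLM.compContinuousAlternatingMap (β.re x) +
      Complex.I • Complex.ofRealCLM.compContinuousAlternatingMap (β.im x)
  rw [hre, him]

/-- **A complex form on `U` is closed on `U` if its real and imaginary parts are.**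
[cite: Wells1980, Ch. II §1] -/
theorem mem_localClosedForms_of_re_of_im {U : Set M} {α : MForm 𝓘(ℝ, E) M ℂ k}
    (hα : α ∈ smoothFormsOn 𝓘(ℝ, E) ℂ U k) (hre : ∀ x ∈ U, mextDeriv α.re x = 0)
    (him : ∀ x ∈ U, mextDeriv α.im x = 0) : α ∈ localClosedForms 𝓘(ℝ, E) ℂ k U := by
  refine ⟨hα, fun x hx ↦ ?_⟩
  have h1 := re_mextDeriv_apply_of_smoothAt (hα.1 x hx)
  have h2 := im_mextDeriv_apply_of_smoothAt (hα.1 x hx)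
  rw [hre x hx] at h1
  rw [him x hx] at h2
  exact MForm.apply_eq_zero_of_re_of_im _ h1 h2

end RealImag

end Literature.Geometry.Kaehler

/-! ### §2 The complex tautness statements -/

namespace Literature.Geometry.Manifold

variable {EM : Type u} [NormedAddCommGroup EM] [NormedSpace ℂ EM] [FiniteDimensional ℂ EM]
  {M : Type u} [TopologicalSpace M] [ChartedSpace EM M] [IsManifold 𝓘(ℝ, EM) ∞ M]
  [CompactSpace M] [T2Space M] [SecondCountableTopology M]
  {EP : Type u} [NormedAddCommGroup EP] [NormedSpace ℂ EP] [FiniteDimensional ℂ EP]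
  {P : Type u} [TopologicalSpace P] [ChartedSpace EP P] [IsManifold 𝓘(ℝ, EP) ∞ P]
  [CompactSpace P] [T2Space P] [SecondCountableTopology P]
  {f : P → M}

/-- **T1 for complex forms, positive degree.** A closed complex `(k+1)`-form `θ` on an open
`W ⊇ f(P)` whose pull-back along the embedding `f` is `dλ` for a smooth complex `k`-form `λ` on
`P` is exact on some open `V` with `f(P) ⊆ V ⊆ W` (real and imaginary parts separately by the
real statement, then recombined). [cite: Spanier1981, Ch. 6 §1, Thm. 10] [cite: Bredon1993, Thm. V.9.5] -/
theorem exists_nhd_restr_mem_localExactForms_of_pullback_eq_mextDeriv_complex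
    (hf : ContMDiff 𝓘(ℝ, EP) 𝓘(ℝ, EM) ∞ f) (hfe : IsEmbedding f) {W : Set M} (hW : IsOpen W)
    (hfW : ∀ y, f y ∈ W) {k : ℕ} {θ : MForm 𝓘(ℝ, EM) M ℂ (k + 1)}
    (hθ : θ ∈ localClosedForms 𝓘(ℝ, EM) ℂ (k + 1) W) {lam : MForm 𝓘(ℝ, EP) P ℂ k}
    (hlam : IsSmoothForm lam) (he : θ.pullback 𝓘(ℝ, EP) f = mextDeriv lam) :
    ∃ (V : Set M) (hV : IsOpen V), V ⊆ W ∧ Set.range f ⊆ V ∧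
      θ.restr V ∈ localExactForms 𝓘(ℝ, EM) ℂ hV (k + 1) := by
  haveI : FiniteDimensional ℝ EM := FiniteDimensional.complexToReal EM
  haveI : FiniteDimensional ℝ EP := FiniteDimensional.complexToReal EP
  -- real and imaginary parts
  have hre : θ.re.pullback 𝓘(ℝ, EP) f = mextDeriv lam.re := by
    rw [← MForm.re_pullback, he, MForm.re_mextDeriv_holds hlam]
  have him : θ.im.pullback 𝓘(ℝ, EP) f = mextDeriv lam.im := by
    rw [← MForm.im_pullback, he, MForm.im_mextDeriv_holds hlam]
  obtain ⟨V₁, hV₁, hV₁W, hK₁, hex₁⟩ :=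
    exists_nhd_restr_mem_localExactForms_of_pullback_eq_mextDeriv hf hfe hW hfW
      (re_mem_localClosedForms hθ) hlam.re hre
  obtain ⟨V₂, hV₂, hV₂W, hK₂, hex₂⟩ :=
    exists_nhd_restr_mem_localExactForms_of_pullback_eq_mextDeriv hf hfe hW hfW
      (im_mem_localClosedForms hθ) hlam.im him
  rw [mem_localExactForms_succ_iff] at hex₁ hex₂
  obtain ⟨g₁, hg₁⟩ := hex₁
  obtain ⟨g₂, hg₂⟩ := hex₂
  have hV : IsOpen (V₁ ∩ V₂) := hV₁.inter hV₂
  refine ⟨V₁ ∩ V₂, hV, inter_subset_left.trans hV₁W, subset_inter hK₁ hK₂, ?_⟩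
  -- the complex primitive `g₁|_V ⊗ 1 + i g₂|_V ⊗ 1`
  have hg₁V : (g₁ : MForm 𝓘(ℝ, EM) M ℝ k).restr (V₁ ∩ V₂) ∈ smoothFormsOn 𝓘(ℝ, EM) ℝ (V₁ ∩ V₂) k :=
    restr_mem_smoothFormsOn hV inter_subset_left g₁.2
  have hg₂V : (g₂ : MForm 𝓘(ℝ, EM) M ℝ k).restr (V₁ ∩ V₂) ∈ smoothFormsOn 𝓘(ℝ, EM) ℝ (V₁ ∩ V₂) k :=
    restr_mem_smoothFormsOn hV inter_subset_right g₂.2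
  set g : MForm 𝓘(ℝ, EM) M ℂ k := ((g₁ : MForm 𝓘(ℝ, EM) M ℝ k).restr (V₁ ∩ V₂)).ofReal +
    Complex.I • ((g₂ : MForm 𝓘(ℝ, EM) M ℝ k).restr (V₁ ∩ V₂)).ofReal with hgdef
  have hg : g ∈ smoothFormsOn 𝓘(ℝ, EM) ℂ (V₁ ∩ V₂) k :=
    add_mem (ofReal_mem_smoothFormsOn hg₁V) (smul_complex_mem_smoothFormsOn _ (ofReal_mem_smoothFormsOn hg₂V))
  rw [mem_localExactForms_succ_iff]
  refine ⟨⟨g, hg⟩, ?_⟩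
  rw [coe_localD]
  -- compare pointwise on `V` (both sides vanish off `V`)
  funext x
  by_cases hx : x ∈ V₁ ∩ V₂
  · rw [MForm.restr_apply_of_mem _ hx, MForm.restr_apply_of_mem _ hx]
    change mextDeriv g x = θ x
    have e₁ : mextDeriv ((g₁ : MForm 𝓘(ℝ, EM) M ℝ k).restr (V₁ ∩ V₂)) x = θ.re x := by
      rw [mextDeriv_restr_apply hV _ hx]
      have := congrFun hg₁ x
      rw [coe_localD, MForm.restr_apply_of_mem _ hx.1, MForm.restr_apply_of_mem _ hx.1] at this
      exact this
    have e₂ : mextDeriv ((g₂ : MForm 𝓘(ℝ, EM) M ℝ k).restr (V₁ ∩ V₂)) x = θ.im x := by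
      rw [mextDeriv_restr_apply hV _ hx]
      have := congrFun hg₂ x
      rw [coe_localD, MForm.restr_apply_of_mem _ hx.2, MForm.restr_apply_of_mem _ hx.2] at this
      exact this
    have hgs : g.SmoothAt x := hg.1 x hx
    have gre : g.re = (g₁ : MForm 𝓘(ℝ, EM) M ℝ k).restr (V₁ ∩ V₂) := by
      rw [hgdef, MForm.re_add, MForm.re_smul, MForm.re_ofReal, MForm.re_ofReal, MForm.im_ofReal]; simp
    have gim : g.im = (g₂ : MForm 𝓘(ℝ, EM) M ℝ k).restr (V₁ ∩ V₂) := by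
      rw [hgdef, MForm.im_add, MForm.im_smul, MForm.im_ofReal, MForm.re_ofReal, MForm.im_ofReal]; simp
    refine MForm.apply_eq_of_re_of_im _ _ ?_ ?_
    · rw [re_mextDeriv_apply_of_smoothAt hgs, gre]; exact e₁
    · rw [im_mextDeriv_apply_of_smoothAt hgs, gim]; exact e₂
  · rw [MForm.restr_apply_of_notMem _ hx, MForm.restr_apply_of_notMem _ hx]

/-- **T1 for complex forms, degree `0`.** A closed complex `0`-form on an open `W ⊇ f(P)`
vanishing on `f(P)` vanishes on some open `V` with `f(P) ⊆ V ⊆ W`. [cite: Spanier1981, Ch. 6 §1, Thm. 10] -/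
theorem exists_nhd_restr_eq_zero_of_pullback_eq_zero_complex
    (hf : ContMDiff 𝓘(ℝ, EP) 𝓘(ℝ, EM) ∞ f) (hfe : IsEmbedding f) {W : Set M} (hW : IsOpen W)
    (hfW : ∀ y, f y ∈ W) {θ : MForm 𝓘(ℝ, EM) M ℂ 0} (hθ : θ ∈ localClosedForms 𝓘(ℝ, EM) ℂ 0 W)
    (he : θ.pullback 𝓘(ℝ, EP) f = 0) :
    ∃ (V : Set M), IsOpen V ∧ V ⊆ W ∧ Set.range f ⊆ V ∧ θ.restr V = 0 := by
  haveI : FiniteDimensional ℝ EM := FiniteDimensional.complexToReal EM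
  haveI : FiniteDimensional ℝ EP := FiniteDimensional.complexToReal EP
  have hre : θ.re.pullback 𝓘(ℝ, EP) f = 0 := by
    rw [← MForm.re_pullback, he]; funext x; ext v; simp
  have him : θ.im.pullback 𝓘(ℝ, EP) f = 0 := by
    rw [← MForm.im_pullback, he]; funext x; ext v; simp
  obtain ⟨V₁, hV₁, hV₁W, hK₁, h₁⟩ :=
    exists_nhd_restr_eq_zero_of_pullback_eq_zero hf hfe hW hfW (re_mem_localClosedForms hθ) hre
  obtain ⟨V₂, hV₂, hV₂W, hK₂, h₂⟩ :=
    exists_nhd_restr_eq_zero_of_pullback_eq_zero hf hfe hW hfW (im_mem_localClosedForms hθ) him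
  refine ⟨V₁ ∩ V₂, hV₁.inter hV₂, inter_subset_left.trans hV₁W, subset_inter hK₁ hK₂, ?_⟩
  funext x
  by_cases hx : x ∈ V₁ ∩ V₂
  · rw [MForm.restr_apply_of_mem _ hx]
    have e₁ := congrFun h₁ x
    have e₂ := congrFun h₂ x
    rw [MForm.restr_apply_of_mem _ hx.1] at e₁
    rw [MForm.restr_apply_of_mem _ hx.2] at e₂
    exact MForm.apply_eq_zero_of_re_of_im θ e₁ e₂
  · rw [MForm.restr_apply_of_notMem _ hx]; rfl

/-- **T2 for complex forms, positive degree.** For every closed smooth complex `(k+1)`-form `lam` on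
`P` and open `W ⊇ f(P)` there are an open `V` with `f(P) ⊆ V ⊆ W`, a complex `(k+1)`-form `ζ`
closed on `V`, and a smooth `k`-form `κ` on `P` with `f^*ζ = lam + dκ`.
[cite: Spanier1981, Ch. 6 §1, Thm. 10] [cite: Bredon1993, Thm. V.9.5] -/
theorem exists_nhd_pullback_eq_add_mextDeriv_complex (hf : ContMDiff 𝓘(ℝ, EP) 𝓘(ℝ, EM) ∞ f)
    (hfe : IsEmbedding f) {W : Set M} (hW : IsOpen W) (hKW : Set.range f ⊆ W) {k : ℕ}
    {lam : MForm 𝓘(ℝ, EP) P ℂ (k + 1)} (hlam : lam ∈ closedSmoothForms 𝓘(ℝ, EP) P ℂ (k + 1)) :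
    ∃ (V : Set M) (_ : IsOpen V), V ⊆ W ∧ Set.range f ⊆ V ∧
      ∃ ζ ∈ localClosedForms 𝓘(ℝ, EM) ℂ (k + 1) V, ∃ κ : MForm 𝓘(ℝ, EP) P ℂ k,
        IsSmoothForm κ ∧ ζ.pullback 𝓘(ℝ, EP) f = lam + mextDeriv κ := by
  haveI : FiniteDimensional ℝ EM := FiniteDimensional.complexToReal EM
  haveI : FiniteDimensional ℝ EP := FiniteDimensional.complexToReal EP
  have hre : lam.re ∈ closedSmoothForms 𝓘(ℝ, EP) P ℝ (k + 1) :=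
    ⟨hlam.1.re, by rw [IsClosedForm, ← MForm.re_mextDeriv_holds hlam.1, hlam.2]; funext x; ext v; simp⟩
  have him : lam.im ∈ closedSmoothForms 𝓘(ℝ, EP) P ℝ (k + 1) :=
    ⟨hlam.1.im, by rw [IsClosedForm, ← MForm.im_mextDeriv_holds hlam.1, hlam.2]; funext x; ext v; simp⟩
  obtain ⟨V₁, hV₁, hV₁W, hK₁, ζ₁, hζ₁, hex₁⟩ := exists_nhd_pullback_sub_mem_exactSmoothForms hf hfe hW hKW hre
  obtain ⟨V₂, hV₂, hV₂W, hK₂, ζ₂, hζ₂, hex₂⟩ := exists_nhd_pullback_sub_mem_exactSmoothForms hf hfe hW hKW him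
  obtain ⟨κ₁, hκ₁, hκ₁e⟩ := exists_eq_mextDeriv_of_mem_exactSmoothForms hex₁
  obtain ⟨κ₂, hκ₂, hκ₂e⟩ := exists_eq_mextDeriv_of_mem_exactSmoothForms hex₂
  have hV : IsOpen (V₁ ∩ V₂) := hV₁.inter hV₂
  have hKV : Set.range f ⊆ V₁ ∩ V₂ := subset_inter hK₁ hK₂
  have hfV : ∀ y, f y ∈ V₁ ∩ V₂ := fun y ↦ hKV ⟨y, rfl⟩
  refine ⟨V₁ ∩ V₂, hV, inter_subset_left.trans hV₁W, hKV, ?_⟩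
  have hζ₁V : ζ₁.restr (V₁ ∩ V₂) ∈ smoothFormsOn 𝓘(ℝ, EM) ℝ (V₁ ∩ V₂) (k + 1) :=
    restr_mem_smoothFormsOn hV inter_subset_left hζ₁.1
  have hζ₂V : ζ₂.restr (V₁ ∩ V₂) ∈ smoothFormsOn 𝓘(ℝ, EM) ℝ (V₁ ∩ V₂) (k + 1) :=
    restr_mem_smoothFormsOn hV inter_subset_right hζ₂.1
  refine ⟨(ζ₁.restr (V₁ ∩ V₂)).ofReal + Complex.I • (ζ₂.restr (V₁ ∩ V₂)).ofReal, ?_,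
    κ₁.ofReal + Complex.I • κ₂.ofReal, hκ₁.ofReal.add ((hκ₂.ofReal).smul_complex _), ?_⟩
  · refine mem_localClosedForms_of_re_of_im
      (add_mem (ofReal_mem_smoothFormsOn hζ₁V) (smul_complex_mem_smoothFormsOn _ (ofReal_mem_smoothFormsOn hζ₂V)))
      (fun x hx ↦ ?_) (fun x hx ↦ ?_)
    · have e : ((ζ₁.restr (V₁ ∩ V₂)).ofReal + Complex.I • (ζ₂.restr (V₁ ∩ V₂)).ofReal).re =
          ζ₁.restr (V₁ ∩ V₂) := by
        rw [MForm.re_add, MForm.re_smul, MForm.re_ofReal, MForm.re_ofReal, MForm.im_ofReal]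
        simp
      rw [e, mextDeriv_restr_apply hV _ hx]
      exact hζ₁.2 x hx.1
    · have e : ((ζ₁.restr (V₁ ∩ V₂)).ofReal + Complex.I • (ζ₂.restr (V₁ ∩ V₂)).ofReal).im =
          ζ₂.restr (V₁ ∩ V₂) := by
        rw [MForm.im_add, MForm.im_smul, MForm.im_ofReal, MForm.re_ofReal, MForm.im_ofReal]
        simp
      rw [e, mextDeriv_restr_apply hV _ hx]
      exact hζ₂.2 x hx.2
  · rw [MForm.pullback_add, MForm.pullback_smul_complex, ← MForm.ofReal_pullback, ← MForm.ofReal_pullback,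
      MForm.pullback_restr_of_forall_mem hfV, MForm.pullback_restr_of_forall_mem hfV,
      mextDeriv_add hκ₁.ofReal ((hκ₂.ofReal).smul_complex _), mextDeriv_smul_complex_holds,
      MForm.mextDeriv_ofReal_holds, MForm.mextDeriv_ofReal_holds, hκ₁e, hκ₂e]
    have hsub : ∀ a b : MForm 𝓘(ℝ, EP) P ℝ (k + 1), (a - b).ofReal = a.ofReal - b.ofReal :=
      fun a b ↦ by funext y; ext v; simp
    rw [hsub, hsub, smul_sub]
    have e0 : lam - (lam.re.ofReal + Complex.I • lam.im.ofReal) = 0 :=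
      sub_eq_zero.2 (MForm.ofReal_re_add_I_smul_ofReal_im lam).symm
    symm
    calc lam + ((ζ₁.pullback 𝓘(ℝ, EP) f).ofReal - lam.re.ofReal +
          (Complex.I • (ζ₂.pullback 𝓘(ℝ, EP) f).ofReal - Complex.I • lam.im.ofReal))
        = (ζ₁.pullback 𝓘(ℝ, EP) f).ofReal + Complex.I • (ζ₂.pullback 𝓘(ℝ, EP) f).ofReal +
            (lam - (lam.re.ofReal + Complex.I • lam.im.ofReal)) := by abel
      _ = (ζ₁.pullback 𝓘(ℝ, EP) f).ofReal + Complex.I • (ζ₂.pullback 𝓘(ℝ, EP) f).ofReal := by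
            rw [e0, add_zero]

/-- **T2 for complex forms, degree `0`.** For every closed smooth complex `0`-form `lam` on `P`
(a locally constant function) and open `W ⊇ f(P)` there are an open `V`, `f(P) ⊆ V ⊆ W`, and a
complex `0`-form `ζ` closed on `V` with `f^*ζ = lam`. [cite: Spanier1981, Ch. 6 §1, Thm. 10] -/
theorem exists_nhd_pullback_eq_complex (hf : ContMDiff 𝓘(ℝ, EP) 𝓘(ℝ, EM) ∞ f)
    (hfe : IsEmbedding f) {W : Set M} (hW : IsOpen W) (hKW : Set.range f ⊆ W)
    {lam : MForm 𝓘(ℝ, EP) P ℂ 0} (hlam : lam ∈ closedSmoothForms 𝓘(ℝ, EP) P ℂ 0) :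
    ∃ (V : Set M) (_ : IsOpen V), V ⊆ W ∧ Set.range f ⊆ V ∧
      ∃ ζ ∈ localClosedForms 𝓘(ℝ, EM) ℂ 0 V, ζ.pullback 𝓘(ℝ, EP) f = lam := by
  haveI : FiniteDimensional ℝ EM := FiniteDimensional.complexToReal EM
  haveI : FiniteDimensional ℝ EP := FiniteDimensional.complexToReal EP
  have hre : lam.re ∈ closedSmoothForms 𝓘(ℝ, EP) P ℝ 0 :=
    ⟨hlam.1.re, by rw [IsClosedForm, ← MForm.re_mextDeriv_holds hlam.1, hlam.2]; funext x; ext v; simp⟩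
  have him : lam.im ∈ closedSmoothForms 𝓘(ℝ, EP) P ℝ 0 :=
    ⟨hlam.1.im, by rw [IsClosedForm, ← MForm.im_mextDeriv_holds hlam.1, hlam.2]; funext x; ext v; simp⟩
  obtain ⟨V₁, hV₁, hV₁W, hK₁, ζ₁, hζ₁, hex₁⟩ := exists_nhd_pullback_sub_mem_exactSmoothForms hf hfe hW hKW hre
  obtain ⟨V₂, hV₂, hV₂W, hK₂, ζ₂, hζ₂, hex₂⟩ := exists_nhd_pullback_sub_mem_exactSmoothForms hf hfe hW hKW him
  -- in degree `0` exact forms are `0`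
  have h₁ : ζ₁.pullback 𝓘(ℝ, EP) f = lam.re := by
    have : ζ₁.pullback 𝓘(ℝ, EP) f - lam.re = 0 := by simpa [exactSmoothForms] using hex₁
    exact sub_eq_zero.1 this
  have h₂ : ζ₂.pullback 𝓘(ℝ, EP) f = lam.im := by
    have : ζ₂.pullback 𝓘(ℝ, EP) f - lam.im = 0 := by simpa [exactSmoothForms] using hex₂
    exact sub_eq_zero.1 this
  have hV : IsOpen (V₁ ∩ V₂) := hV₁.inter hV₂
  have hKV : Set.range f ⊆ V₁ ∩ V₂ := subset_inter hK₁ hK₂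
  have hfV : ∀ y, f y ∈ V₁ ∩ V₂ := fun y ↦ hKV ⟨y, rfl⟩
  refine ⟨V₁ ∩ V₂, hV, inter_subset_left.trans hV₁W, hKV,
    (ζ₁.restr (V₁ ∩ V₂)).ofReal + Complex.I • (ζ₂.restr (V₁ ∩ V₂)).ofReal, ?_, ?_⟩
  · have hζ₁V : ζ₁.restr (V₁ ∩ V₂) ∈ smoothFormsOn 𝓘(ℝ, EM) ℝ (V₁ ∩ V₂) 0 :=
      restr_mem_smoothFormsOn hV inter_subset_left hζ₁.1
    have hζ₂V : ζ₂.restr (V₁ ∩ V₂) ∈ smoothFormsOn 𝓘(ℝ, EM) ℝ (V₁ ∩ V₂) 0 :=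
      restr_mem_smoothFormsOn hV inter_subset_right hζ₂.1
    refine mem_localClosedForms_of_re_of_im
      (add_mem (ofReal_mem_smoothFormsOn hζ₁V) (smul_complex_mem_smoothFormsOn _ (ofReal_mem_smoothFormsOn hζ₂V)))
      (fun x hx ↦ ?_) (fun x hx ↦ ?_)
    · have e : ((ζ₁.restr (V₁ ∩ V₂)).ofReal + Complex.I • (ζ₂.restr (V₁ ∩ V₂)).ofReal).re =
          ζ₁.restr (V₁ ∩ V₂) := by
        rw [MForm.re_add, MForm.re_smul, MForm.re_ofReal, MForm.re_ofReal, MForm.im_ofReal]; simp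
      rw [e, mextDeriv_restr_apply hV _ hx]; exact hζ₁.2 x hx.1
    · have e : ((ζ₁.restr (V₁ ∩ V₂)).ofReal + Complex.I • (ζ₂.restr (V₁ ∩ V₂)).ofReal).im =
          ζ₂.restr (V₁ ∩ V₂) := by
        rw [MForm.im_add, MForm.im_smul, MForm.im_ofReal, MForm.re_ofReal, MForm.im_ofReal]; simp
      rw [e, mextDeriv_restr_apply hV _ hx]; exact hζ₂.2 x hx.2
  · rw [MForm.pullback_add, MForm.pullback_smul_complex, ← MForm.ofReal_pullback, ← MForm.ofReal_pullback,
      MForm.pullback_restr_of_forall_mem hfV, MForm.pullback_restr_of_forall_mem hfV, h₁, h₂]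
    exact MForm.ofReal_re_add_I_smul_ofReal_im lam

end Literature.Geometry.Manifold
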